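import Literature.Probability.Percolation.AnchoredIsoperimetricProfileProofs
import HarnessLib

/-!
# The anchored isoperimetric profile: the cutset competitor and the Borel–Cantelli step (proofs)

Second PROOFS companion of `AnchoredIsoperimetricProfile.lean` (after
`AnchoredIsoperimetricProfileProofs.lean`); everything here is proved, no named facts. Source:

* [Dembin2020] B. Dembin, *Existence of the anchored isoperimetric profile in supercritical bond
  percolation in dimension two and higher*, ALEA 17 (2020), §4 (proof of the upper large
  deviations) and §1 ("Theorem 1.1 follows from [the upper and lower large deviations] by a
  straightforward application of the Borel–Cantelli Lemma").

## Contents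

* §4 The deterministic core of the upper large deviations [Dembin2020, §4]: for a set of edges
  `Γ`, the set `H_Γ` of vertices joined to `0` by open paths using no edge of `Γ` is confined by
  `Γ` ("`Γ_n` cuts `nP` from infinity"), is a valid subgraph when finite ("by definition, the set
  `H_n` is connected … a subgraph of `C_∞`"), and every OPEN edge of its edge boundary lies in `Γ`
  ("`|∂_{C_∞} H_n| = |∂° H_n| ≤ |Γ_n|_o`, where the last inequality comes from the fact that, by
  construction of `H_n`, if `e ∈ ∂ H_n ∖ Γ_n`, then `e` is necessarily closed"), whence
  `φ̂_n ≤ |Γ|_o / |H_Γ|`. (In the paper `Γ_n` is assembled from minimal cutsets of the face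
  cylinders of a polytope `nP ⊂ nW_p` and `|H_n|` is estimated by renormalisation — the
  probabilistic part, not formalised.)
* §5 The Borel–Cantelli step: summable two-sided tails for `n φ̂_n` on `{C(0) infinite}` give the
  almost sure limit, i.e. `CerfDembin2020_thm11` CONDITIONALLY on the large deviation estimates
  (`CerfDembin2020_thm11_of_largeDeviations`; not a discharge).
-/

noncomputable section

namespace Literature.Probability.Percolation

open Finset LatticeModels
open _root_.MeasureTheory _root_.Filter
open scoped _root_.Topology ENNReal

variable {d : ℕ}

/-! ## §4 The deterministic core of the upper large deviations (Dembin2020 §4) -/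

section Cutset

/-- **Confinement.** If `0 ∈ S` and every open pair `s(a, b) ∈ ω` leaving `S` (`a ∈ S`, `b ∉ S`)
belongs to `Γ`, then the vertices joined to `0` by open paths avoiding `Γ` stay in `S`
([Dembin2020, §4]: "`Γ_n` cuts `nP` from infinity", so `H_n` lies inside).
[cite: Dembin2020, §4 (construction of H_n from the cutset Γ_n)] -/
theorem openCluster_diff_subset {V : Type*} {ω Γ : BondConfig V} {S : Set V} {o : V} (ho : o ∈ S)
    (hΓ : ∀ ⦃a b : V⦄, a ∈ S → b ∉ S → s(a, b) ∈ ω → s(a, b) ∈ Γ) :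
    openCluster (ω \ Γ) o ⊆ S := by
  have hclosed : ∀ ⦃a b : V⦄, a ∈ S → (openGraph (ω \ Γ)).Adj a b → b ∈ S := by
    intro a b ha hab
    rw [openGraph_adj] at hab
    by_contra hb
    exact hab.1.2 (hΓ ha hb hab.1.1)
  rintro x ⟨p⟩
  exact support_subset_of_adj_closed hclosed p ho x p.end_mem_support

/-- **`H_Γ` is a valid subgraph** ([Dembin2020, §4]: "By definition, the set `H_n` is connected.
As we condition on the event `{0 ∈ C_∞}`, the set `H_n` is a subgraph of `C_∞`"): when finite,
the set of vertices joined to `0` by open paths using no edge of `Γ` is a valid subgraph of `C(0)`.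
[cite: Dembin2020, §4 (construction of H_n from the cutset Γ_n)] -/
theorem isValidSubgraph_toFinset_openCluster_diff {ω Γ : BondConfig (Site d)}
    (hfin : (openCluster (ω \ Γ) 0).Finite) : IsValidSubgraph d ω hfin.toFinset := by
  classical
  refine ⟨by simp, fun x hx => ?_⟩
  rw [Set.Finite.mem_toFinset] at hx
  obtain ⟨p⟩ := hx
  refine mem_openConnIn_of_openWalk (p.mapLe (openGraph_diff_le ω Γ)) fun z hz => ?_
  rw [SimpleGraph.Walk.support_mapLe_eq_support] at hz
  rw [Set.Finite.coe_toFinset]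
  exact mem_openCluster_of_mem_support p hz

/-- **Open boundary edges of `H_Γ` lie in `Γ`** ([Dembin2020, §4]: "if `e ∈ ∂H_n ∖ Γ_n`, then `e`
is necessarily closed"): an open lattice edge with exactly one endpoint in `H_Γ` that avoided `Γ`
would extend an open `Γ`-avoiding path across the boundary.
[cite: Dembin2020, §4 (|∂° H_n| ≤ |Γ_n|_o)] -/
theorem edgeBoundary_inter_subset_of_openCluster_diff {ω Γ : BondConfig (Site d)}
    (hfin : (openCluster (ω \ Γ) 0).Finite) :
    ((↑(edgeBoundary (zdGraph d) hfin.toFinset) : Set (Sym2 (Site d))) ∩ ω) ⊆ Γ := by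
  classical
  rintro e ⟨he, heω⟩
  rw [Finset.mem_coe, mem_edgeBoundary_iff] at he
  obtain ⟨-, ⟨a, ha, hae⟩, ⟨b, hb, hbe⟩⟩ := he
  rw [Set.Finite.mem_toFinset] at ha hb
  have hne : a ≠ b := fun h => hb (h ▸ ha)
  have heq : e = s(a, b) := (Sym2.mem_and_mem_iff hne).1 ⟨hae, hbe⟩
  subst heq
  by_contra heΓ
  exact hb (SimpleGraph.Reachable.trans ha (SimpleGraph.Adj.reachable
    ((openGraph_adj (ω \ Γ) a b).2 ⟨⟨heω, heΓ⟩, hne⟩)))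

/-- Hence `|∂° H_Γ| ≤ |Γ|_o`, the number of open edges of a finite `Γ`
([Dembin2020, §4]: "`|∂_{C_∞} H_n| = |∂° H_n| ≤ |Γ_n|_o`").
[cite: Dembin2020, §4 (|∂° H_n| ≤ |Γ_n|_o)] -/
theorem openEdgeBoundaryCard_openCluster_diff_le {ω Γ : BondConfig (Site d)} (hΓ : Γ.Finite)
    (hfin : (openCluster (ω \ Γ) 0).Finite) :
    openEdgeBoundaryCard d ω hfin.toFinset ≤ (Γ ∩ ω).ncard := by
  rw [openEdgeBoundaryCard]
  refine Set.ncard_le_ncard (fun e he => ⟨?_, he.2⟩) (hΓ.inter_of_left ω)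
  exact edgeBoundary_inter_subset_of_openCluster_diff hfin he

/-- **The competitor `H_Γ` bounds the profile**: if `Γ` is finite and `H_Γ` is finite with
`|H_Γ| ≤ n^d`, then `φ̂_n ≤ |Γ|_o / |H_Γ|` — the deterministic skeleton of the upper large
deviations [Dembin2020, §4, proof of Theorem (ULD)], where `Γ = Γ_n` is built from minimal
cutsets of the face cylinders of `nP` and `|H_n| ≥ (θ_p - δ)(1 - δ) L^d(nP)` by renormalisation.
[cite: Dembin2020, §4 (|∂° H_n| ≤ |Γ_n|_o)] -/
theorem anchoredProfile_le_ncard_div_of_cutset {n : ℕ} {ω Γ : BondConfig (Site d)}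
    (hΓ : Γ.Finite) (hfin : (openCluster (ω \ Γ) 0).Finite) (hn : hfin.toFinset.card ≤ n ^ d) :
    anchoredProfile d n ω ≤ ((Γ ∩ ω).ncard : ℝ) / hfin.toFinset.card := by
  refine (anchoredProfile_le_div (isValidSubgraph_toFinset_openCluster_diff hfin) hn).trans ?_
  have hpos : (0 : ℝ) < hfin.toFinset.card := by
    exact_mod_cast (isValidSubgraph_toFinset_openCluster_diff hfin).card_pos
  exact div_le_div_of_nonneg_right
    (by exact_mod_cast openEdgeBoundaryCard_openCluster_diff_le hΓ hfin) hpos.le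

/-- The lattice form of confinement used in [Dembin2020, §4]: if `Γ` contains every lattice edge
of `ℤ^d` leaving a finite `S ∋ 0` (i.e. `∂ S ⊆ Γ`) and `ω ⊆ E(ℤ^d)`, then `H_Γ ⊆ S`; in
particular `H_Γ` is finite. [cite: Dembin2020, §4 (construction of H_n from the cutset Γ_n)] -/
theorem openCluster_diff_subset_of_edgeBoundary_subset {ω Γ : BondConfig (Site d)}
    (hω : ω ⊆ (zdGraph d).edgeSet) {S : Finset (Site d)} (h0 : (0 : Site d) ∈ S)
    (hΓ : (↑(edgeBoundary (zdGraph d) S) : Set (Sym2 (Site d))) ⊆ Γ) :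
    openCluster (ω \ Γ) 0 ⊆ (↑S : Set (Site d)) := by
  classical
  refine openCluster_diff_subset (Finset.mem_coe.2 h0) fun a b ha hb hab => hΓ ?_
  rw [Finset.mem_coe, mem_edgeBoundary_iff]
  exact ⟨hω hab, ⟨a, ha, Sym2.mem_mk_left a b⟩, ⟨b, hb, Sym2.mem_mk_right a b⟩⟩

end Cutset

/-! ## §5 Theorem 1.1 from two-sided large deviations (Borel–Cantelli) -/


/-- **Borel–Cantelli glue.** If for every `ε > 0` the measures of the events
`E ∩ {ε ≤ |X_n - c|}` are summable, then almost everywhere on `E`, `X_n → c`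
([Dembin2020, §1]: "Theorem 1.1 follows from [the upper and lower large deviations] by a
straightforward application of the Borel–Cantelli Lemma"; first Borel–Cantelli lemma,
Mathlib's `MeasureTheory.ae_eventually_notMem`, along `ε = 1/(k+1)`). [folklore] -/
theorem ae_tendsto_of_tsum_measure_inter_ne_top {Ω : Type*} [MeasurableSpace Ω] {μ : Measure Ω}
    {E : Set Ω} {X : ℕ → Ω → ℝ} {c : ℝ}
    (h : ∀ ε : ℝ, 0 < ε → (∑' n, μ (E ∩ {ω | ε ≤ |X n ω - c|})) ≠ ∞) :
    ∀ᵐ ω ∂μ, ω ∈ E → Tendsto (fun n => X n ω) atTop (𝓝 c) := by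
  have hk : ∀ k : ℕ, ∀ᵐ ω ∂μ, ∀ᶠ n in atTop,
      ω ∉ E ∩ {ω | (1 : ℝ) / ((k : ℝ) + 1) ≤ |X n ω - c|} :=
    fun k => ae_eventually_notMem (h _ Nat.one_div_pos_of_nat)
  have hk' : ∀ᵐ ω ∂μ, ∀ k : ℕ, ∀ᶠ n in atTop,
      ω ∉ E ∩ {ω | (1 : ℝ) / ((k : ℝ) + 1) ≤ |X n ω - c|} := ae_all_iff.2 hk
  filter_upwards [hk'] with ω hω hE
  rw [Metric.tendsto_atTop]
  intro ε hε
  obtain ⟨k, hk⟩ := exists_nat_one_div_lt hε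
  obtain ⟨N, hN⟩ := eventually_atTop.1 (hω k)
  refine ⟨N, fun n hn => ?_⟩
  have hn' := hN n hn
  simp only [Set.mem_inter_iff, Set.mem_setOf_eq, not_and, not_le] at hn'
  rw [Real.dist_eq]
  exact (hn' hE).trans hk

/-- **Theorem 1.1 from two-sided large deviations** — the last step of the printed proof
([Dembin2020, §1]: Theorem 1.1 "follows from Theorem [ULD] and Theorem [LLD] by a
straightforward application of the Borel–Cantelli Lemma"; ULD/LLD give, for `p > p_c` and
`φ = φ(p) > 0`, `P[n φ_n ≥ (1+ε)φ | 0 ∈ C_∞] ≤ C₁ e^{-C₂ n}` and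
`P[n φ_n ≤ (1-ε)φ | 0 ∈ C_∞] ≤ C₁ e^{-C₂ n^{1-3/2d}}`, both summable in `n`). Stated with the
two bounds merged into one summable two-sided tail on the event `{C(0) infinite}`; this is a
CONDITIONAL reduction, not a discharge of `CerfDembin2020_thm11` (the large deviations
themselves are the unformalised 40 pages of [Dembin2020]).
[cite: Dembin2020, §1 (Theorem 1.1 from ULD and LLD by Borel–Cantelli)] -/
theorem CerfDembin2020_thm11_of_largeDeviations
    (hLD : ∀ d : ℕ, 2 ≤ d → ∀ p : unitInterval,
      criticalProb (zdGraph d) (0 : Site d) < (p : ℝ) →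
        ∃ φ : ℝ, 0 < φ ∧ ∀ ε : ℝ, 0 < ε →
          (∑' n : ℕ, bondPercolation (zdGraph d) p
            ({ω | (openCluster ω 0).Infinite} ∩
              {ω | ε ≤ |(n : ℝ) * anchoredProfile d n ω - φ|})) ≠ ∞) :
    CerfDembin2020_thm11 := by
  intro d hd p hp
  obtain ⟨φ, hφ, h⟩ := hLD d hd p hp
  exact ⟨φ, hφ, ae_tendsto_of_tsum_measure_inter_ne_top h⟩

/-! ## §5b Consequences of Theorem 1.1 in the form used by the routes -/

/-- **Supercritical anchored isoperimetry from Theorem 1.1** (the `liminf` half, in the form of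
the route item `SamePAnchoredIsoperimetry` of `PercThresholdOne` restricted to `p > p_c`): if
`n φ̂_n(p) → φ(p) > 0` a.s. on `{C(0) infinite}` ([CerfDembin2020, Thm 1.1]), then a.s. on
`{C(0) infinite}` there are `c > 0` and `N` with `c |K| ≤ n |∂° K|` for all `n ≥ N` and all valid
`K` with `|K| ≤ n^d` (take `c = φ/2` and `N` with `n φ̂_n > φ/2` for `n ≥ N`; `φ̂_n ≤ |∂°K|/|K|`).
A corollary of the NAMED FACT, proved from it; not a discharge.
[cite: CerfDembin2020, Thm 1.1 (consequence: liminf n φ̂_n > 0 on {0 ∈ C_∞})] -/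
theorem CerfDembin2020_thm11.ae_exists_mul_card_le (h : CerfDembin2020_thm11) (hd : 2 ≤ d)
    (p : unitInterval) (hp : criticalProb (zdGraph d) (0 : Site d) < (p : ℝ)) :
    ∀ᵐ ω ∂(bondPercolation (zdGraph d) p), (openCluster ω 0).Infinite →
      ∃ c : ℝ, 0 < c ∧ ∃ N : ℕ, ∀ n : ℕ, N ≤ n → ∀ K : Finset (Site d),
        IsValidSubgraph d ω K → K.card ≤ n ^ d →
          c * K.card ≤ (n : ℝ) * (openEdgeBoundaryCard d ω K : ℝ) := by
  obtain ⟨φ, hφ, hae⟩ := h d hd p hp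
  filter_upwards [hae] with ω hω hinf
  have hev : ∀ᶠ n : ℕ in atTop, φ / 2 < (n : ℝ) * anchoredProfile d n ω :=
    (hω hinf).eventually_const_lt (by linarith)
  obtain ⟨N, hN⟩ := eventually_atTop.1 hev
  refine ⟨φ / 2, by linarith, N, fun n hn K hK hcard => ?_⟩
  have h1 : φ / 2 < n * anchoredProfile d n ω := hN n hn
  have h2 : anchoredProfile d n ω ≤ (openEdgeBoundaryCard d ω K : ℝ) / K.card :=
    anchoredProfile_le_div hK hcard
  have hpos : (0 : ℝ) < K.card := by exact_mod_cast hK.card_pos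
  calc φ / 2 * K.card ≤ ((n : ℝ) * anchoredProfile d n ω) * K.card :=
        mul_le_mul_of_nonneg_right h1.le hpos.le
    _ ≤ ((n : ℝ) * ((openEdgeBoundaryCard d ω K : ℝ) / K.card)) * K.card :=
        mul_le_mul_of_nonneg_right (mul_le_mul_of_nonneg_left h2 (Nat.cast_nonneg n)) hpos.le
    _ = (n : ℝ) * (openEdgeBoundaryCard d ω K : ℝ) := by
        rw [mul_assoc, div_mul_cancel₀ _ hpos.ne']

/-- **The `limsup` half of Theorem 1.1 in competitor form**: if `n φ̂_n(p) → φ(p)` a.s. on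
`{C(0) infinite}` ([CerfDembin2020, Thm 1.1]), then a.s. on `{C(0) infinite}`, for all large `n`
there is a valid `K` with `|K| ≤ n^d` and `n |∂° K| ≤ 2 φ |K|` (the minimiser of `φ̂_n`, which is
attained). A corollary of the NAMED FACT, proved from it; not a discharge.
[cite: CerfDembin2020, Thm 1.1 (consequence: limsup n φ̂_n < ∞ on {0 ∈ C_∞})] -/
theorem CerfDembin2020_thm11.ae_eventually_exists_competitor (h : CerfDembin2020_thm11) (hd : 2 ≤ d)
    (p : unitInterval) (hp : criticalProb (zdGraph d) (0 : Site d) < (p : ℝ)) :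
    ∃ φ : ℝ, 0 < φ ∧ ∀ᵐ ω ∂(bondPercolation (zdGraph d) p), (openCluster ω 0).Infinite →
      ∀ᶠ n : ℕ in atTop, ∃ K : Finset (Site d), IsValidSubgraph d ω K ∧ K.card ≤ n ^ d ∧
        (n : ℝ) * (openEdgeBoundaryCard d ω K : ℝ) ≤ 2 * φ * K.card := by
  obtain ⟨φ, hφ, hae⟩ := h d hd p hp
  refine ⟨φ, hφ, ?_⟩
  filter_upwards [hae] with ω hω hinf
  have hev : ∀ᶠ n : ℕ in atTop, (n : ℝ) * anchoredProfile d n ω < 2 * φ :=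
    (hω hinf).eventually_lt_const (by linarith)
  filter_upwards [hev, eventually_ge_atTop 1] with n hn hn1
  obtain ⟨K, hK, hpos, hcard, heq⟩ := exists_isValidSubgraph_anchoredProfile_eq hn1 ω
  refine ⟨K, hK, hcard, ?_⟩
  have hposR : (0 : ℝ) < K.card := by exact_mod_cast hpos
  rw [heq] at hn
  calc (n : ℝ) * (openEdgeBoundaryCard d ω K : ℝ)
      = ((n : ℝ) * ((openEdgeBoundaryCard d ω K : ℝ) / K.card)) * K.card := by
        rw [mul_assoc, div_mul_cancel₀ _ hposR.ne']
    _ ≤ 2 * φ * K.card := mul_le_mul_of_nonneg_right hn.le hposR.le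

end Literature.Probability.Percolation
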